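import Summits.MatrixMultiplication.OmegaCensus.STPPKernelBitsets

/-!
# ω-census (abelian STPP census): kernel CHECKER for the (3,13) two-above zoo at p = 61 (fifth ℤ₆₁ leaf, cell (2,2))

HONEST FRAMING (pub-omega census; verbatim): lottery ticket; floor = certified bounds/negative ranges.
Census STRUCTURE (seat pub-omega-stpp-1 gen 33, 2026-08-29), family (b2).  The structure-free cell of the slack-4 law for the fifth ℤ₆₁ leaf
(`STPPVosperSlackFourLawT.lean`, HOME `pub-omega-stpp-1-g33/FIFTH-LEAF.md`) needs the classification of the pairs `(X, Y)`, `|X| = 3`, `|Y| = 13`,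
`|X + Y| = 17` in `ℤ/61` (TWO above Cauchy–Davenport; no inverse theorem in print for a 3-element set).  Normal form: `X = {0, 1, y}` (affine),
`0 ∈ Y`, `60 ∉ Y` (translation: a run of `Y` starts at `0`).  Then `Y = {0 = v₀ < v₁ < … < v₁₂ ≤ 59}` is its DIFFERENCE SEQUENCE `dᵢ = vᵢ − vᵢ₋₁ ≥ 1`
(`Σ dᵢ ≤ 59`); with `r = 1 + #{i : dᵢ ≥ 2}` runs, `|Y ∪ (Y+1)| = 13 + r` and `|X + Y| = 13 + r + #{b ∈ Y : b + y ∉ Y ∪ (Y+1)}`, so two-above needs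
`r ≤ 4` and exactly `4 − r` failures.  `zooGo` enumerates the difference sequences with at most `3` entries `≥ 2` depth-first (3 639 211 leaves), and at
each leaf `zooLeaf` computes, for ALL `y` at once by bit-parallel failure counters over the 13 elements, the set of `y ∈ [2, 59]` with exactly `4 − r`
failures, and requires each such `(y, mask Y)` to be in the table (`STPPZoo313TableP1–4.lean`, 2 562 pairs).  Rows: `zooGo 61 zooTbl61 k S bb pos mask els
= true` over a frontier of prefixes (chunks ≤ 15k leaves ≈ 60 s).  Soundness (generator completeness, counter semantics, the cardinality identity) is a
separate file.  Python mirror: HOME `pub-omega-stpp-1-g33/code/zoo313.py` (by runs) / `zoo_mirror.py`.  Nothing here is progress on `ω`.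

References: H. Cohn, R. Kleinberg, B. Szegedy, C. Umans, FOCS 2005 (arXiv:math/0511460), Def. 5.1.
-/

namespace Summit.MatrixMultiplication.OmegaCensus.CubeNB.S2

open Summit.MatrixMultiplication.OmegaCensus.CubeNB.Bits

/-- One step of the bit-parallel failure counters `[c₀, c₁, …, c_K]` (`cⱼ` = the `y`'s with exactly `j` failures so far) for an element whose
SUCCESS set is `S`: `c₀ ↦ c₀ ∧ S`, `cⱼ ↦ (cⱼ ∧ S) ∨ (cⱼ₋₁ ∧ ¬S)`; `y`'s exceeding `K` failures are dropped. [folklore] -/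
def stepCnt (p S : ℕ) : List ℕ → List ℕ
  | [] => []
  | c0 :: cs => (c0 &&& S) :: stepCnt.rest p S c0 cs
where
  /-- the higher counters, given the previous (un-updated) counter -/
  rest (p S : ℕ) : ℕ → List ℕ → List ℕ
  | _, [] => []
  | prev, c :: cs => ((c &&& S) ||| (prev &&& (fullMask p ^^^ S))) :: rest p S c cs

/-- The `y`-range mask: bits `2, …, p − 2`. [folklore] -/
def yRangeMask (p : ℕ) : ℕ := (fullMask p ^^^ 3) ^^^ (1 <<< (p - 1))

/-- **Leaf of the zoo search.**  `mask` = the 13-set `Y` (`0 ∈ Y`, `max Y ≤ p − 2`), `els` = its elements, `K` = allowed failures (`= 4 − #runs`):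
`U₁ = Y ∪ (Y+1)` (no wrap), doubled to `U₂` so that the success set of an element `b` — the `y` with `b + y ∈ U₁ (mod p)` — is `(U₂ >>> b) ∧ fullMask`;
the `y ∈ [2, p−2]` with exactly `K` failures must all be table entries `(y, mask)`. [folklore] -/
def zooLeaf (p : ℕ) (tbl : List (ℕ × ℕ)) (K mask : ℕ) (els : List ℕ) : Bool :=
  let U1 := mask ||| (mask <<< 1)
  let U2 := U1 ||| (U1 <<< p)
  let cnt := els.foldl (fun cs b => stepCnt p ((U2 >>> b) &&& fullMask p) cs) (fullMask p :: List.replicate K 0)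
  let H := cnt.getLastD 0 &&& yRangeMask p
  Nat.beq H 0 || (members (List.range p) H).all fun y => decide ((y, mask) ∈ tbl)

/-- **Depth-first enumeration of the difference sequences** with `k` entries still to choose, remaining sum budget `S` (so that the last element stays
`≤` the initial budget), at most `bb` further entries `≥ 2`, current last element `pos`, current mask and element list; at the leaves `zooLeaf` with
`K = bb` (the unused big-entry budget IS the number of allowed failures, `4 − r`). [folklore] -/
def zooGo (p : ℕ) (tbl : List (ℕ × ℕ)) : ℕ → ℕ → ℕ → ℕ → ℕ → List ℕ → Bool
  | 0, _, bb, _, mask, els => zooLeaf p tbl bb mask els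
  | k + 1, S, bb, pos, mask, els =>
    (List.range' 1 (S - k)).all fun d =>
      cond (Nat.ble 2 d)
        (Nat.beq bb 0 || zooGo p tbl k (S - d) (bb - 1) (pos + d) (mask ||| (1 <<< (pos + d))) ((pos + d) :: els))
        (zooGo p tbl k (S - d) bb (pos + d) (mask ||| (1 <<< (pos + d))) ((pos + d) :: els))

/-- **The zoo check from a prefix** `pre` of the difference sequence (for `n`-element sets in `ℤ/p`, last element `≤ p − 2`, at most `B` big entries):
all completions pass their leaves. [folklore] -/
def zooCheckPre (p n B : ℕ) (tbl : List (ℕ × ℕ)) (pre : List ℕ) : Bool :=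
  let pos := pre.sum
  let mask := (pre.scanl (· + ·) 0).foldl (fun m v => m ||| (1 <<< v)) 0
  let els := (pre.scanl (· + ·) 0).reverse
  let bigs := (pre.filter fun d => Nat.ble 2 d).length
  !(Nat.ble bigs B) || zooGo p tbl (n - 1 - pre.length) (p - 2 - pos) (B - bigs) pos mask els

end Summit.MatrixMultiplication.OmegaCensus.CubeNB.S2
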